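import Literature.NumberTheory.GaloisRepresentations.HochschildSerreEdge
import Literature.NumberTheory.GaloisRepresentations.PadicQuotientHOneCoinvariants
import HarnessLib

/-!
# The Hochschild–Serre edge lands in `Ker(H²(G, M) → H²(N, M))`; hence for a `ℤ_p`-quotient:
# `res² : H²(G, M) → H²(N, M)` injective ⟹ `H¹(N, M) = (γ − 1) H¹(N, M)`

Topic `NumberTheory/GaloisRepresentations`; namespace `Literature.NumberTheory.GaloisRepresentations`.
Theorems only (no definition, no named fact; D-0026).

Let `G` be a profinite group, `N ⊴ G` a closed normal subgroup and `M` a discrete `G`-module.  The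
low-degree exact sequence of the Hochschild–Serre spectral sequence (Harari, *Galois Cohomology and
Class Field Theory*, Prop. A.66; Neukirch–Schmidt–Wingberg (2.4.1))

  `… → H²(G/N, M^N) → Ker(H²(G, M) → H²(N, M)) → H¹(G/N, H¹(N, M)) → H³(G/N, M^N)`

says that under `H²(G/N, M^N) = H³(G/N, M^N) = 0` the edge `E₂^{1,1} = H¹(G/N, H¹(N, M)) → H²(G, M)`
(the tree's `hsEdge`, `HochschildSerreEdge.lean`, proved injective there) is an isomorphism ONTO THE
KERNEL OF RESTRICTION.  This file adds the half of this that the tree lacks and that Iwasawa theory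
uses:

* `resSubgroup_two_hsEdge` — **`res ∘ hsEdge = 0`**: the edge class `δ₁ (Inf y)` restricts to
  `δ₁ (res (Inf y)) = δ₁ 0 = 0` on `N` (`res ∘ δ₁ = δ₁ ∘ res`, `res ∘ Inf = 0` in degree one);
* `subsingleton_one_hOneRep_of_resSubgroup_two_injective` — **if `res² : H²(G, M) → H²(N, M)` is
  injective then `H¹(G/N, H¹(N, M)) = 0`**;
* `exists_conjMap_sub_eq_of_resSubgroup_two_injective` — for a `ℤ_p`-QUOTIENT (`φ : G ↠ ℤ_p`
  continuous, `N = ker φ`, `φ γ = 1`, `cd_p(G/N) ≤ 1` so that the two vanishing hypotheses hold for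
  `p`-primary `M`): **if `res²` is injective then every class of `H¹(N, M)` is `γ · t − t`**, i.e.
  `H¹(N, M)_Γ = 0` — the module `H¹(N, M)` is «`(γ − 1)`-divisible» (`PadicQuotientHOneCoinvariants`).

This is the mechanism behind Greenberg's «`H¹(F_Σ/F, 𝒜)/θ_s ↪ H²(F_Σ/F, 𝒜[θ_s])`» (LNM 1716, §4
Appendix, pp. 116–117, with Prop. 4.10 = Shapiro) in its Hochschild–Serre form: the coinvariants of
`H¹(K_∞, A)` under `Γ = Gal(K_∞/K) ≅ ℤ_p` inject into `H²(K, A)`, and vanish as soon as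
`H²(K, A) → H²(K_∞, A)` is injective (e.g. when `H²(K, A)` is controlled by local and Ш² terms that
die over `K_∞`).  HONEST FRAMING: generic profinite group cohomology; nothing about any curve or
summit is asserted.

## References
* D. Harari, *Galois Cohomology and Class Field Theory* (2020), Thm. 1.44, Prop. A.66. [Harari2020]
* J. Neukirch, A. Schmidt, K. Wingberg, *Cohomology of Number Fields* (2008), (1.6.7), (2.4.1).
  [NeukirchSchmidtWingberg2008]
* R. Greenberg, *Iwasawa theory for elliptic curves*, LNM 1716 (1999), §4 Appendix, Prop. 4.10 and
  pp. 116–117. [GreenbergLNM1716]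
* J.-P. Serre, *Corps locaux* (1979), XIII §1 Prop. 1. [SerreLocalFields1979]
-/

noncomputable section

open CategoryTheory ContinuousCohomology Function
open _root_.TopRep _root_.Topology _root_.Filter

universe u

namespace Literature.NumberTheory.GaloisRepresentations

section Edge

variable {G : Type u} [Group G] [TopologicalSpace G] [IsTopologicalGroup G] [CompactSpace G] [T2Space G]
  [TotallyDisconnectedSpace G]
variable (N : Subgroup G) [N.Normal] [hN : IsClosed (N : Set G)]
variable {M : Type u} [AddCommGroup M] [TopologicalSpace M] [DiscreteTopology M]
variable (ρ : ContinuousRep G ℤ M)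

/-- **The Hochschild–Serre edge lands in `Ker(res : H²(G, M) → H²(N, M))`.** For
`y ∈ H¹(G/N, H¹(N, M))` write `y = H¹(δ_N) z` (dimension shift through `C = C(G, M)`, `Q = C/M`);
then `hsEdge y = δ₁ (Inf z)` and `res (δ₁ (Inf z)) = δ₁ (res (Inf z)) = δ₁ 0 = 0`.
[cite: Harari2020, Prop A.66] [cite: NeukirchSchmidtWingberg2008, (2.4.1)] -/
theorem resSubgroup_two_hsEdge [Subsingleton (continuousCohomology 2 (ρ.quotientInvariants N).toTopRep)]
    [Subsingleton (continuousCohomology 3 (ρ.quotientInvariants N).toTopRep)]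
    (y : continuousCohomology 1 (hOneRep N ρ).toTopRep) :
    resSubgroup ρ.toTopRep N 2 (hsEdge N ρ y) = 0 := by
  haveI hNc : CompactSpace N := isCompact_iff_compactSpace.mp hN.isCompact
  haveI := subsingleton_coind ρ 0
  haveI := subsingleton_coind_restrict N ρ 0
  haveI := subsingleton_coind_invariants N ρ 0
  haveI := subsingleton_coind_invariants N ρ 1
  have h := isSES_coind ρ
  have hN' := isSES_coind_restrict N ρ
  obtain ⟨z, hz⟩ := IsSES.cohomologyMap_deltaNHom_surjective N h y
  have e1 : hsEdge N ρ y = h.δ₁ (infOne N ρ.coindQuot z) := by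
    rw [← hz]
    exact IsSES.hsEdge_cohomologyMap_deltaNHom N h z
  have e2 : resSubgroup ρ.toTopRep N 2 (h.δ₁ (infOne N ρ.coindQuot z)) =
      hN'.δ₁ (resSubgroup ρ.coindQuot.toTopRep N 1 (infOne N ρ.coindQuot z)) :=
    resSubgroup_δ₁ N h hN' (infOne N ρ.coindQuot z)
  have e3 : resSubgroup ρ.coindQuot.toTopRep N 1 (infOne N ρ.coindQuot z) = 0 :=
    (infOne_exact_resSubgroup N ρ.coindQuot).apply_apply_eq_zero z
  rw [e1, e2]
  exact (congrArg hN'.δ₁ e3).trans (map_zero _)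

/-- **`res² : H²(G, M) → H²(N, M)` injective ⟹ `H¹(G/N, H¹(N, M)) = 0`** (under
`H²(G/N, M^N) = H³(G/N, M^N) = 0`): the edge is injective (`hsEdge_injective`) with image in the
kernel of restriction (`resSubgroup_two_hsEdge`). [cite: Harari2020, Prop A.66] [cite: NeukirchSchmidtWingberg2008, (2.4.1)] -/
theorem subsingleton_one_hOneRep_of_resSubgroup_two_injective
    [Subsingleton (continuousCohomology 2 (ρ.quotientInvariants N).toTopRep)]
    [Subsingleton (continuousCohomology 3 (ρ.quotientInvariants N).toTopRep)]
    (hinj : ∀ x : continuousCohomology 2 ρ.toTopRep, resSubgroup ρ.toTopRep N 2 x = 0 → x = 0) :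
    Subsingleton (continuousCohomology 1 (hOneRep N ρ).toTopRep) := by
  refine ⟨fun a b => ?_⟩
  have ha : hsEdge N ρ a = 0 := hinj _ (resSubgroup_two_hsEdge N ρ a)
  have hb : hsEdge N ρ b = 0 := hinj _ (resSubgroup_two_hsEdge N ρ b)
  exact hsEdge_injective N ρ (ha.trans hb.symm)

omit [T2Space G] [TotallyDisconnectedSpace G] [N.Normal] in
/-- `H¹(N, M)` is `p`-primary when `M` is: a continuous cocycle on the compact group `N` with values
in the discrete `p`-primary module `M` takes finitely many values. [cite: Shatz1972, Ch. II §2 Prop. 6 (proof)] -/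
theorem isPrimaryTorsion_continuousCohomology_one_subgroupRep {p : ℕ} (hM : IsPrimaryTorsion p M) :
    IsPrimaryTorsion p (continuousCohomology 1 (subgroupRep ρ.toTopRep N)) := by
  haveI hNc : CompactSpace N := isCompact_iff_compactSpace.mp hN.isCompact
  intro s
  obtain ⟨z, rfl⟩ := oneCocycleClass_surjective _ s
  obtain ⟨r, hr⟩ := IsPrimaryTorsion.continuousMap (X := N) hM z.1
  refine ⟨r, ?_⟩
  have hz : p ^ r • z = 0 := Subtype.ext (by rw [Submodule.coe_smul_of_tower, Submodule.coe_zero]; exact hr)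
  change p ^ r • oneCocycleClassₗ (subgroupRep ρ.toTopRep N) z = 0
  rw [← map_nsmul (oneCocycleClassₗ (subgroupRep ρ.toTopRep N)), hz, map_zero]

end Edge

/-! ### `ℤ_p`-quotients: `res²` injective forces `H¹(N, M) = (γ − 1) H¹(N, M)` -/

section ZpQuotient

variable {G : Type u} [Group G] [TopologicalSpace G] [IsTopologicalGroup G] [CompactSpace G] [T2Space G]
  [TotallyDisconnectedSpace G]
variable {p : ℕ} [hp : Fact p.Prime] (φ : G →ₜ* Multiplicative ℤ_[p])
variable (N : Subgroup G) [N.Normal] [hN : IsClosed (N : Set G)]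
variable {M : Type u} [AddCommGroup M] [TopologicalSpace M] [DiscreteTopology M]
variable (ρ : ContinuousRep G ℤ M)

/-- **`res²` injective ⟹ every class of `H¹(N, M)` is `γ · t − t`** for the kernel `N` of a
continuous surjection `φ : G ↠ ℤ_p` of a profinite group, `φ γ = 1 ∈ ℤ_p`, `cd_p(G/N) ≤ 1`, and a
discrete `p`-primary `G`-module `M`: from `H²(G/N, ·) = H³(G/N, ·) = 0` on `p`-primary modules, the edge
gives `H¹(G/N, H¹(N, M)) = 0` (`subsingleton_one_hOneRep_of_resSubgroup_two_injective`), and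
`H¹(ℤ_p, D) = 0 ⟹ D = (γ − 1) D` (`exists_apply_sub_eq_of_subsingleton_one`). This is the
group-cohomological core of «`H¹(K_∞, A)_Γ ↪ H²(K, A)`» (Greenberg, LNM 1716, §4 Appendix
pp. 116–117 / Prop. 4.10). [cite: GreenbergLNM1716, §4 Appendix Prop. 4.10 and pp. 116–117]
[cite: NeukirchSchmidtWingberg2008, (2.4.1)] [cite: SerreLocalFields1979, XIII §1 Prop. 1] -/
theorem exists_conjMap_sub_eq_of_resSubgroup_two_injective (hφ : Surjective φ)
    (hNφ : ∀ g : G, g ∈ N ↔ φ g = 1) {γ : G} (hγ : φ γ = Multiplicative.ofAdd 1)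
    (hcd : GroupCdLE (G ⧸ N) p 1) (hM : IsPrimaryTorsion p M)
    (hinj : ∀ x : continuousCohomology 2 ρ.toTopRep, resSubgroup ρ.toTopRep N 2 x = 0 → x = 0)
    (s : continuousCohomology 1 (subgroupRep ρ.toTopRep N)) :
    ∃ t : continuousCohomology 1 (subgroupRep ρ.toTopRep N), conjMap ρ.toTopRep N γ 1 t - t = s := by
  -- `M^N` is `p`-primary, so `H²(G/N, M^N) = H³(G/N, M^N) = 0`
  have hMN : IsPrimaryTorsion p (ρ.invariantsOf N) := fun m => by
    obtain ⟨r, hr⟩ := hM (m : M)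
    exact ⟨r, Subtype.ext (by rw [Submodule.coe_smul_of_tower, Submodule.coe_zero]; exact hr)⟩
  haveI : Subsingleton (continuousCohomology 2 (ρ.quotientInvariants N).toTopRep) :=
    hcd _ (ρ.quotientInvariants N) hMN (by norm_num)
  haveI : Subsingleton (continuousCohomology 3 (ρ.quotientInvariants N).toTopRep) :=
    hcd _ (ρ.quotientInvariants N) hMN (by norm_num)
  haveI hH1 : Subsingleton (continuousCohomology 1 (hOneRep N ρ).toTopRep) :=
    subsingleton_one_hOneRep_of_resSubgroup_two_injective N ρ hinj
  -- `H¹(N, M)` is `p`-primary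
  have hD : ∀ d : HOne N ρ, ∃ e : ℕ, p ^ e • d = 0 :=
    isPrimaryTorsion_continuousCohomology_one_subgroupRep N ρ hM
  obtain ⟨v, hv⟩ := exists_apply_sub_eq_of_subsingleton_one φ N (hOneRep N ρ) hφ hNφ hγ hD
    (HOne.of N ρ s)
  refine ⟨(HOne.of N ρ).symm v, ?_⟩
  rw [hOneRep_mk_apply] at hv
  exact hv

end ZpQuotient

end Literature.NumberTheory.GaloisRepresentations

end
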